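import Summits.AtomisticToContinuum.HydrodynamicLimit.Theorems.AntiMazurCoboundariesCellForecastPressureDecayObjects
import Summits.AtomisticToContinuum.HydrodynamicLimit.Theorems.AntiMazurCoboundariesCellForecastPressureDecayPolymerRepresentation
import Summits.AtomisticToContinuum.HydrodynamicLimit.Theorems.AntiMazurCoboundariesCellForecastPressureDecayLabelCumulantDifferentiable
import Summits.AtomisticToContinuum.HydrodynamicLimit.Theorems.AntiMazurCoboundariesCellForecastPressureDecayDobrushinHolomorphicLog
import Summits.AtomisticToContinuum.HydrodynamicLimit.Theorems.AntiMazurCoboundariesCellForecastPressureDecayCumulantTaylorBridge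
import Summits.AtomisticToContinuum.HydrodynamicLimit.Theorems.CellForecastPressureDecay.Negative.PerParticle
import Literature.Probability.LatticeModels.CumulantRecursion
import HarnessLib.Audit

/-!
# Line `tilt-analyticity-transfer` for the crux `CellForecastPressureDecay` (stmt-AtomisticToContinuum-13915)

Route `AntiMazurCoboundaries`, crux #6 (the N-free core):
`∃ σ₀ ∀ σ<σ₀ ∃ κ ∀ g (continuous, |g| ≤ κ, g ⊥ span(1,v,|v|²)) ∀ δ ∃ T ∃ R₀ ∀ R ≥ R₀ ∃ L₀ ∀ L ≥ L₀ ∀ n ≤ 2L³ ∀ Ψ ∀ |c| ≤ 1: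
 ∫⁻ exp(2c Σᵢ T⁻¹∫₀ᵀ g(forecast velocity of i)) dP_{n,L} ≤ e^{δ L³}`.

## The lever (crux idea `tilt-analyticity-transfer`, triage r1: pass ×3)

COMPLEXIFY THE TILT. Write the left side as the value at real `c` of the entire function
`Z(c) = tiltZ … c = ∫ exp(2c·Σᵢ aᵢ) dP_{n,L}` (`aᵢ = windowAvg`, `|aᵢ| ≤ κ`). The crux is
`sup_{|c|≤1} L⁻³ log Z(c) ≤ δ` once `T` is large. Split it into
* (i) UNIFORM TILT-ANALYTICITY — a BOUND, uniform in `T`: `Z` is zero-free on the complex disc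
  `|c| < 2` with a holomorphic logarithm of volume order, `Z = exp(L³ q)`, `q(0) = 0`, `‖q‖ ≤ M`.
  Typed here, as the triage asked (r1-3 sharpen; r1-2 "crux ∧ (i): (i) is the whole new content"), in
  the currency its natural proof consumes: `stub_siteSummableLabelCumulants` = the Kotecký–Preiss SITE
  criterion `Σ_{B∋i} ‖κ_B(c)‖ e^{a|B|} ≤ a` for the joint cumulants `κ_B` of the LABEL FIELD
  `u_j(c) = e^{2c a_j} − 1`, uniformly in `T ≥ T₀` (and in `R, L, n ≤ 2L³, Ψ`, `|c| < 2`); the passage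
  "site criterion ⇒ holomorphic volume-order log" is the abstract, known `stub_koteckyPreissLog`
  (Dobrushin's inductive criterion is PROVED in the tree: `Literature.Probability.LatticeModels.
  polymerPartitionFunction_ne_zero_and_ratio_le`; polymers = nonempty label sets, activities = joint
  cumulants, incompatibility = intersection; moment–cumulant formula = the polymer representation).
* (ii) FIXED-ORDER DECAY — qualitative, rate-free, NOT uniform in the order: for each fixed `k` the
  `k`-th Taylor coefficient at `0` of the normalised logarithm `q = L⁻³ log Z` is eventually `≤ η`
  (`stub_fixedOrderCumulantDecay`, stated branch-free: for EVERY local holomorphic `q` with `q 0 = 0`,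
  `exp(L³ q) = Z` near `0` — they all have the same jet). `k = 1`: boundary layer; `k = 2`: the cell
  twin of the shared L² milestone FastObservableMeanErgodic (10952); `k ≥ 3`: Cesàro decay of k-point
  truncated time correlations per volume.
* TRANSFER (PROVED here, `taylorTailControl`): Cauchy's estimate on `|c| = 3/2` turns the bound (i)
  into the `T`-uniform majorant `M(2/3)^k` of the Taylor series on `|c| ≤ 1`; (ii) kills the head:
  `‖q‖ ≤ δ` on the closed unit disc, effective in `(M, δ) ↦ (K, η)` chosen BEFORE `T`.
The LD content of the crux beyond its L² sibling is exactly uniformity over the cumulant order `k`;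
complex analyticity in the tilt converts that uniformity into the bound (i).

## Composition (kernel-checked, sorry-free)
`CellForecastPressureDecay_of : stub_siteSummableLabelCumulants → stub_koteckyPreissLog →
stub_fixedOrderCumulantDecay → AntiMazurCoboundaries.CellForecastPressureDecay`
(D-0027 §3.3 shape: `def stub_x : Prop := type_of% Holds.stub_x`). Proved inside: `σ₀ := min (min σ₁ σ₃) (3/16)`,
`κ := min κ₁ κ₃`; `(K, η) := taylorTailControl (2a) δ`; the thresholds of (i) and of (ii) for `k < K`
are merged (`Frame.and`, `frame_finite`) into `T := max T₁ T₃`, `R₀`, `L₀ := max L₀' 1`; the cell law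
is a probability measure (landed `Negative/WithoutOrthogonality.isProbabilityMeasure_cellLaw`, σ ≤ 3/16,
L ≥ 1); window averages are measurable and `|aᵢ| ≤ κ` (`measurable_windowAvg`, `abs_windowAvg_le`);
KP gives `q'` with `exp q' = Z`, `‖q'‖ ≤ a n ≤ 2a L³`; `q := L⁻³ q'` has `‖q‖ ≤ 2a` on `|c| < 2` and,
by (ii), `‖q^{(k)}(0)‖ ≤ η` for `k < K`; `taylorTailControl` ⇒ `‖q(c)‖ ≤ δ` for real `|c| ≤ 1`;
`‖Z(c)‖ = exp(Re q') ≤ exp(δL³)`; and at real `c` the crux's `lintegral` IS `‖Z(c)‖`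
(`lintegral_exp_eq_norm_tiltZ`: `ofReal_integral_eq_lintegral_ofReal` + `integral_ofReal`).

## Disproof used (`Cruxes/CellForecastPressureDecay/Disproof.lean`, cdisprove cycle 1: NO KILL; landed
`Theorems/CellForecastPressureDecay/Negative/{WithoutOrthogonality,LoneParticle,PerParticle}.lean`, imported)
* `cellForecastPressureDecay_false_without_orthogonality` (g ≡ κ): honoured at `stub_fixedOrderCumulantDecay`,
  `k = 1` — for `g ≡ κ` the first coefficient is `2κ n/L³ ↛ 0`; both dynamical stubs CARRY the
  orthogonality hypothesis (k = 2 needs all of span(1,v,|v|²): conserved `v`, `|v|²` components are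
  Drude weights). `stub_siteSummableLabelCumulants` alone does NOT refute `g ≡ κ` (it holds there:
  `u_j` constant, `κ_B = 0` for `|B| ≥ 2`) — consistent: the witness kills (ii), not (i).
* `cellForecastPressureDecay_false_perParticle` (n = 1, `e^{δn}`): every bound here is per VOLUME
  (`‖q'‖ ≤ a·n ≤ 2aL³`, coefficients of `L⁻³ log Z`); for `n = 1`, `windowAverage_one` gives
  `Z(c) = ∫M e^{2cg}` at every `T`, entire and zero-free on `|c|<2` for `κ ≤ 1/8` ((i) ✓), and its
  normalised jet is `O(L⁻³)` ((ii) ✓ because `L₀` is chosen after `T`, exactly as in the crux).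
* § 7 near-miss (amplitude clause): the energy-shell mode is a common component `(c g″/n)·ξ`,
  `ξ = n(θ̂−1)² ~ (2/3)χ²₁`, of all `u_j`; its joint cumulants `(cg″/n)^k κ_k(ξ)`, `κ_k(ξ) = (4/3)^k (k−1)!/2`,
  contribute `n⁻¹ Σ_k (4|c|g″e^a/3)^k` to the site sum — geometric, convergent iff `|c| g″ < 3e^{-a}/4`:
  the `∃κ` floor is where `stub_siteSummableLabelCumulants` diverges (the card's real branch point
  `c* = 3/(8G₂)`, now with the KP margin `e^{-a}`), so `∃κ` is used AT stub 1, not by a side computation.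
* § 1 frame (`isProbabilityMeasure_cellLaw`) is used verbatim in the composition; § 5 `gW` is the test
  observable for the MD falsifier of stub 1 (line card).
No stub is an instance of a landed Negative lemma (stubs 1, 3 carry orthogonality, amplitude `∃κ` and
per-volume normalisation; stub 2 is abstract combinatorics/complex analysis).

## Lead's reshape (prover-line-stmt-AtomisticToContinuum-13915-0, 2026-08-16)
* `jointCumulant` is now defined by the ANCHORED moment–cumulant recursion (`cumulantOfMoments`:
  `κ(B) = m(B) − Σ_{A ⊂ B, min B ∈ A} κ(A) m(B∖A)`, `κ(∅) = 0`) instead of the Möbius sum over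
  `Finpartition B` — the same numbers (the anchored relations characterise the Ursell functions), but the
  polymer representation becomes a strong induction on the label set matching
  `polymerPartitionFunction_insert`, with no Möbius inversion on the partition lattice.
* The known stub `stub_koteckyPreissLog` is SPLIT into three registered stubs proved in parallel:
  `stub_polymerRepresentation` (S2a: `E∏_{j∈S}(1+u_j) = subsetGasZ (jointCumulant P u) S`, combinatorics +
  linearity), `stub_labelCumulantDifferentiable` (S2b: `c ↦ κ_B(c)` is entire for bounded `w_j`, via
  `ProbabilityTheory.complexMGF`), `stub_dobrushinHolomorphicLog` (S2c: site criterion ⇒ Dobrushin ⇒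
  zero-free subset polymer gas with a holomorphic logarithm `q`, `q 0 = 0`, `‖q‖ ≤ a n`, abstract in the
  activities); their composition `labelFieldHolomorphicLog_of_parts` re-proves the planner's stub 2
  statement (`LabelFieldHolomorphicLog`) inside this file, so `CellForecastPressureDecay_of` is unchanged
  in substance.
* A bookkeeping stub `stub_objects` (S0: unfolding/vanishing of the anchored cumulants, `subsetGasZ 0 = 1`)
  rides with the objects module `Theorems/AntiMazurCoboundariesCellForecastPressureDecayObjects.lean`
  (namespace `…Theorems.TiltAnalyticity`, LANDED p80905), which this skeleton and every stub file import.
Registered stubs after the reshape (6 ≤ stubs_max): `stub_objects` (S0, CLOSED p80905),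
`stub_siteSummableLabelCumulants` (S1, hardest, lead, OPEN), `stub_polymerRepresentation` (S2a, CLOSED
p85268), `stub_labelCumulantDifferentiable` (S2b, CLOSED p85159), `stub_dobrushinHolomorphicLog` (S2c,
CLOSED p84862), and the planner's S3 `stub_fixedOrderCumulantDecay` RESHAPED (wave 2) into
`stub_cumulantTaylorBridge` (S3a, known: cumulants = Taylor coefficients of any local holomorphic log of
the MGF, tree `CumulantsAnalytic`) and `stub_cellCumulantDecay` (S3b, the open content in plain cumulant
currency: ‖κ_{k+1}(2Σᵢaᵢ)‖ ≤ ηL³ eventually; order 1 needs first-moment InfluenceLocality 13916 + a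
cell→torus bulk reduction, order 2 is the cell twin of FastObservableMeanErgodic 10952), with
`fixedOrderCumulantDecay_of_parts` re-proving the planner's S3 statement (`FixedOrderCumulantDecay`) here.
After wave 2 (S3a CLOSED p89323) the skeleton's only `sorry`s are S1 and S3b — exactly the open
dynamical content of the crux.
-/

open MeasureTheory Set Metric Filter ProbabilityTheory Topology
open scoped ENNReal BigOperators
open Literature.Analysis.FluidPDE Literature.MathematicalPhysics.KineticTheory
open Literature.Probability.LatticeModels (polymerPartitionFunction cumulantOf)
open Summit.AtomisticToContinuum.HydrodynamicLimit.Theorems.TiltAnalyticity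

namespace Summit.AtomisticToContinuum.HydrodynamicLimit.Cruxes.CellForecastPressureDecay.TiltAnalyticityTransfer

noncomputable section

/-! ## § Objects: imported from `Theorems/AntiMazurCoboundariesCellForecastPressureDecayObjects.lean`
(landed p80905, namespace `Summit.AtomisticToContinuum.HydrodynamicLimit.Theorems.TiltAnalyticity`, opened) -/

/-- The quantifier FRAME shared by the crux and the dynamical stubs after `T`:
`∀ T ≥ T₀ ∃ R₀ ∀ R ≥ R₀ ∃ L₀ ∀ L ≥ L₀ ∀ n ≤ 2L³ ∀ Ψ, P T R L n Ψ`. -/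
def Frame {σ : ℝ} (P : ℝ → ℝ → ℝ → (n : ℕ) → Flows σ → Prop) (T₀ : ℝ) : Prop :=
  ∀ T : ℝ, T₀ ≤ T → ∃ R₀ : ℝ, 0 < R₀ ∧ ∀ R : ℝ, R₀ ≤ R → ∃ L₀ : ℝ, 0 < L₀ ∧ ∀ L : ℝ, L₀ ≤ L →
    ∀ n : ℕ, (n : ℝ) ≤ 2 * L ^ 3 → ∀ Ψ : Flows σ, P T R L n Ψ

/-! ## Registered stubs (`Holds.stub_*`, bodies `sorry`) -/

namespace Holds

/-- STUB S0 — OBJECTS BOOKKEEPING (CLOSED — proved in the objects module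
`Theorems/AntiMazurCoboundariesCellForecastPressureDecayObjects.lean`, `stub_objects`): (i) unfolding of
the anchored cumulant recursion, (ii) vanishing of the anchored cumulants when all moments of nonempty
sets vanish, (iii) the subset polymer gas at zero activity has partition function `1`. -/
theorem stub_objects :
    (∀ (ι : Type) [LinearOrder ι] (m : Finset ι → ℂ) (B : Finset ι) (h : B.Nonempty),
      cumulantOfMoments m B = m B -
        ∑ A ∈ B.powerset.filter (fun A => A ⊂ B ∧ B.min' h ∈ A),
          cumulantOfMoments m A * m (B \ A)) ∧
    (∀ (ι : Type) [LinearOrder ι] (m : Finset ι → ℂ),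
      (∀ d : Finset ι, d.Nonempty → m d = 0) → ∀ B : Finset ι, cumulantOfMoments m B = 0) ∧
    (∀ (ι : Type) [DecidableEq ι] (S : Finset ι), subsetGasZ (fun _ => (0 : ℂ)) S = 1) :=
  -- CLOSED: landed in the objects module (p80905)
  Summit.AtomisticToContinuum.HydrodynamicLimit.Theorems.TiltAnalyticity.stub_objects

/-- STUB S1 — SITE-SUMMABLE LABEL CUMULANTS, UNIFORMLY IN THE WINDOW (the HARDEST stub; the whole
new content of the line = card (i) in Kotecký–Preiss currency, as triage r1-3 asked). For `σ < σ₀`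
there is an amplitude `κ` such that for every admissible `g` there are a KP weight `a > 0` and a
horizon `T₀` with: for `T ≥ T₀` (then `R ≥ R₀(T)`, `L ≥ L₀`, `n ≤ 2L³`, any `Ψ`), every complex tilt
`|c| < 2` and every label `i`,
  `Σ_{B ∋ i} ‖κ_B(c)‖ · e^{a|B|} ≤ a`,
`κ_B(c)` the joint cumulant (anchored recursion = Ursell function) under `P_{n,L}` of the label field
`(e^{2c a_j} − 1)_{j ∈ B}`. Content: under `P_{n,L}` the labels are EXCHANGEABLE (positions integrated
out), so the sum is `Σ_k C(n−1,k−1) |κ_k| e^{ak}` and the stub asks the size-of-chaos scaling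
`|κ_k| ≲ (k−1)!·(Cκ)^k n^{1−k} × (no growth in T)`: `k` labels are correlated only through a collision
tree connecting them inside the window, each label's window average being correlated with the tree for
a time `O(t_mf)` out of `T`, whence heuristically `Σ_{B∋i,|B|=k} |κ_B| ≍ (C'κ)^k k^{k−2}/(k−1)!·(t_mf/T)`
— geometric in `k` with DECAY in `T`; the stub asks only BOUNDEDNESS; the STATIC (`T`-independent)
part is the canonical-ensemble cluster expansion of the cell law (finite-`n` constraint cumulants
`≍ (k−1)! n^{1−k} x^k`, PulvirentiTsagkarogiannis2012). This is BGSS's cumulant hierarchy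
(BGSSAnnals2023: cumulant generating functional analytic over Lanford's time, Boltzmann–Grad) at FIXED σ
and ALL kinetic times — the "uniform-in-time bound on resummed objects" of `NoDensityExpansionNarrow`
item 1. Consistency: collisionless / σ → 0: `a_j = g(v_j)` i.i.d. up to the canonical constraint,
singleton term `e^a(e^{4κ}−1) ≤ a` for `κ` small ✓; `g ≡ κ` (Disproof §2): holds (constant labels,
`κ_B = 0` for `|B| ≥ 2`) ✓ — orthogonality is NOT what this stub consumes; energy-shell / hydrodynamic
slow modes: common components of amplitude `κ/(#labels in the mode)` give `n⁻¹Σ_k(4|c|g″e^a/3)^k`,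
convergent iff `κ < κ*(a)` — the `∃κ` clause is consumed HERE. Why it might fail: a hidden persistent
many-label correlation at fixed σ (ring/recollision resummation failing at high order uniformly in T).
Size XL (open). Leans on: BGSSAnnals2023, BGSSCPAM2023 Thm 1.1, BodineauEtAl2024 Thm 1.2–1.3,
PulvirentiTsagkarogiannis2012, Ruelle1969 Thm 4.2.3. -/
theorem stub_siteSummableLabelCumulants :
    ∃ σ₀ : ℝ, 0 < σ₀ ∧ ∀ σ : ℝ, 0 < σ → σ < σ₀ → ∃ κ : ℝ, 0 < κ ∧ ∀ g : V3 → ℝ, Continuous g →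
      (∀ v, |g v| ≤ κ) →
      (∀ (c₀ c₂ : ℝ) (b : V3),
        ∫ v, g v * (c₀ + inner ℝ b v + c₂ * ‖v‖ ^ 2) ∂(stdGaussian V3) = 0) →
      ∃ a : ℝ, 0 < a ∧ ∃ T₀ : ℝ, 0 < T₀ ∧ ∀ T : ℝ, T₀ ≤ T → ∃ R₀ : ℝ, 0 < R₀ ∧ ∀ R : ℝ, R₀ ≤ R →
        ∃ L₀ : ℝ, 0 < L₀ ∧ ∀ L : ℝ, L₀ ≤ L → ∀ n : ℕ, (n : ℝ) ≤ 2 * L ^ 3 →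
          ∀ Ψ : (k : ℕ) → HardSphereFlow (Euclidean.geometry (Fin 3)) σ k,
            ∀ c : ℂ, ‖c‖ < 2 → ∀ i : Fin n,
              ∑ B ∈ (Finset.univ : Finset (Finset (Fin n))).filter (fun B => i ∈ B),
                ‖jointCumulant (cellLaw σ n L (Ψ n)) (labelField Ψ R T g c) B‖ *
                  Real.exp (a * B.card) ≤ a := by
  sorry

/-- STUB S2a (CLOSED, p85268) — POLYMER REPRESENTATION OF LABEL MOMENTS (known; size M; combinatorics + linearity).
For bounded measurable complex variables `u_j` (`j : Fin n`) on a probability space and every label set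
`S`: `E ∏_{j∈S} (1 + u_j) = subsetGasZ (jointCumulant P u) S`, the partition function of the hard-core
subset polymer gas on `S` (polymers = nonempty subsets of `S`, incompatible iff overlapping) with the
joint cumulants as activities. Proof plan: `E∏_{j∈S}(1+u_j) = Σ_{A⊆S} m(A)` (`Finset.prod_add`,
integrability from boundedness), and both `Φ(S) := Σ_{A⊆S} m(A)` and `Ξ(S) := subsetGasZ κ S` satisfy,
for `s = min S`, `S₀ = S.erase s`: `X(S) = X(S₀) + Σ_{D ⊆ S, s ∈ D} κ(D) X(S ∖ D)` — `Φ` by the anchored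
formula `moment_eq_cumulant_add` applied to every `A ∋ s` (whose minimum is `s`) and re-summation over
`A ⊇ D`, `Ξ` by `polymerPartitionFunction_insert` (insert the polymers `D ∋ s` one at a time: they are
pairwise incompatible, and the polymers of `S₀` compatible with `D` are those of `S ∖ D`) — then strong
induction on `|S|` from `Φ(∅) = 1 = Ξ(∅)`. Leans on: `cumulantOfMoments_eq` / `moment_eq_cumulant_add`
(objects module), `polymerPartitionFunction_insert`, `Finset.prod_add`, `integral_finset_sum`. -/
theorem stub_polymerRepresentation :
    ∀ (Ω : Type) [MeasurableSpace Ω] (P : Measure Ω) [IsProbabilityMeasure P] (n : ℕ)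
      (u : Fin n → Ω → ℂ) (C : ℝ), (∀ j, Measurable (u j)) → (∀ j ω, ‖u j ω‖ ≤ C) →
      ∀ S : Finset (Fin n), ∫ ω, ∏ j ∈ S, (1 + u j ω) ∂P = subsetGasZ (jointCumulant P u) S :=
  -- CLOSED: landed p85268 (Theorems/AntiMazurCoboundariesCellForecastPressureDecayPolymerRepresentation.lean)
  Summit.AtomisticToContinuum.HydrodynamicLimit.Theorems.TiltAnalyticity.stub_polymerRepresentation

/-- STUB S2b (CLOSED, p85159) — THE LABEL CUMULANTS ARE ENTIRE IN THE TILT (known; size M). For bounded measurable real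
`w_j` on a probability space, every joint cumulant `c ↦ κ_B(c)` of the label variables
`u_j(c) = e^{2c w_j} − 1` is differentiable on `ℂ`. Proof plan: the moments are finite signed sums of
complex moment generating functions, `E∏_{j∈d}(e^{2cw_j} − 1) = Σ_{e⊆d} (−1)^{|d∖e|} complexMGF (Σ_{j∈e} w_j) P (2c)`
(`Finset.prod_add`), each entire because `integrableExpSet` of a bounded variable is `univ`
(`ProbabilityTheory.hasDerivAt_complexMGF`); then strong induction on `B` through the anchored recursion
`cumulantOfMoments_eq` (finite sums and products of differentiable functions). -/
theorem stub_labelCumulantDifferentiable :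
    ∀ (Ω : Type) [MeasurableSpace Ω] (P : Measure Ω) [IsProbabilityMeasure P] (n : ℕ)
      (w : Fin n → Ω → ℝ) (A : ℝ), (∀ j, Measurable (w j)) → (∀ j ω, |w j ω| ≤ A) →
      ∀ B : Finset (Fin n), Differentiable ℂ (fun c : ℂ => jointCumulant P (labelVar w c) B) :=
  -- CLOSED: landed p85159 (Theorems/AntiMazurCoboundariesCellForecastPressureDecayLabelCumulantDifferentiable.lean)
  Summit.AtomisticToContinuum.HydrodynamicLimit.Theorems.TiltAnalyticity.stub_labelCumulantDifferentiable

/-- STUB S2c (CLOSED, p84862) — DOBRUSHIN ⇒ A HOLOMORPHIC VOLUME-ORDER LOGARITHM (known; size M–L; the tree PROVES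
Dobrushin's inductive criterion `polymerPartitionFunction_ne_zero_and_ratio_le` and the exclusion bound
`norm_polymerPartitionFunction_sdiff_div_le`). Abstract in the activities: if `κ c B` is holomorphic on
the tilt disc `|c| < ρ`, vanishes at `c = 0` and at `B = ∅`, and satisfies the SITE criterion
`Σ_{B∋i} ‖κ c B‖ e^{a|B|} ≤ a` for every `|c| < ρ` and every site `i`, then the subset polymer gas on all
labels has a holomorphic logarithm `q` on the disc with `q 0 = 0`, `exp (q c) = subsetGasZ (κ c) univ`,
`‖q c‖ ≤ a n`. Proof plan: with `μ_B = ‖κ c B‖e^{a|B|}`, Dobrushin's condition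
`‖κ_B‖∏_{B'∈N}(1+μ_{B'}) ≤ μ_B` for every finite `N` of polymers overlapping `B` follows from
`∏(1+μ) ≤ exp Σ μ` and `Σ_{B' overlapping B} μ_{B'} ≤ Σ_{x∈B}Σ_{B'∋x}μ_{B'} ≤ a|B|`; hence every
`Ξ_Λ(κ c) ≠ 0`; enumerate the nonempty subsets (`Finset.induction`): by `polymerPartitionFunction_insert`
and the exclusion bound, `Ξ_{insert B Λ}/Ξ_Λ = 1 + w_B(c)` with `‖w_B‖ ≤ μ_B/(1+μ_B) < 1`, so
`q := Σ_B Complex.log (1 + w_B)` is holomorphic (`DifferentiableAt.clog`, values in `re > 0`; `Ξ_Λ(κ c)`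
is a polynomial in the holomorphic activities), `exp q = Ξ` (`Complex.exp_log`), `q 0 = 0`
(`κ 0 = 0 ⇒ Ξ(0) = 1`, `subsetGasZ_zero`), and `‖log(1+w_B)‖ ≤ μ_B(2+μ_B)/(2(1+μ_B)) ≤ μ_B`
(`Complex.norm_log_one_add_le`), `Σ_{B≠∅} μ_B ≤ Σ_i Σ_{B∋i} μ_B ≤ n a`. -/
theorem stub_dobrushinHolomorphicLog :
    ∀ (n : ℕ) (κ : ℂ → Finset (Fin n) → ℂ) (ρ a : ℝ), 0 < ρ → 0 < a →
      (∀ B : Finset (Fin n), DifferentiableOn ℂ (fun c => κ c B) (ball 0 ρ)) →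
      (∀ B : Finset (Fin n), κ 0 B = 0) → (∀ c : ℂ, κ c ∅ = 0) →
      (∀ c : ℂ, ‖c‖ < ρ → ∀ i : Fin n,
        ∑ B ∈ (Finset.univ : Finset (Finset (Fin n))).filter (fun B => i ∈ B),
          ‖κ c B‖ * Real.exp (a * B.card) ≤ a) →
      ∃ q : ℂ → ℂ, DifferentiableOn ℂ q (ball 0 ρ) ∧ q 0 = 0 ∧ ∀ c : ℂ, ‖c‖ < ρ →
        Complex.exp (q c) = subsetGasZ (κ c) Finset.univ ∧ ‖q c‖ ≤ a * n :=
  -- CLOSED: landed p84862 (Theorems/AntiMazurCoboundariesCellForecastPressureDecayDobrushinHolomorphicLog.lean)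
  Summit.AtomisticToContinuum.HydrodynamicLimit.Theorems.TiltAnalyticity.stub_dobrushinHolomorphicLog

/-- STUB S3a (CLOSED, p89323) — CUMULANTS ARE THE TAYLOR COEFFICIENTS OF ANY LOCAL HOLOMORPHIC LOGARITHM OF THE MOMENT
GENERATING FUNCTION (known; size M; reshape of the planner's S3 by the lead, 2026-08-16). For a bounded
measurable real variable `Y` on a probability space and ANY `F` holomorphic on a tilt disc with
`F 0 = 0` and `exp (F c) = E e^{cY}` there, `F^{(k+1)}(0) = κ_{k+1}(Y)`, the `(k+1)`-st cumulant of
the moment sequence `m ↦ E Y^m` (tree `Literature.Probability.LatticeModels.cumulantOf`, Möbius form).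
Proof plan: `f := complexMGF Y P` is entire for bounded `Y` (`integrableExpSet = univ`,
`ProbabilityTheory.analyticAt_complexMGF`), `f 0 = 1`, `f = exp ∘ F` near `0` (the disc is a
neighbourhood), `F` is analytic at `0` (`DifferentiableOn.analyticAt`, `Metric.isOpen_ball`), so the
tree theorem `Literature.Probability.LatticeModels.iteratedDeriv_succ_eq_cumulantOf` (file
`CumulantsAnalytic.lean`) gives `F^{(k+1)}(0) = cumulantOf (fun m => f^{(m)}(0)) (k+1)`, and
`f^{(m)}(0) = E[Y^m]` by `ProbabilityTheory.iteratedDeriv_complexMGF` at `z = 0`. -/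
theorem stub_cumulantTaylorBridge :
    ∀ (Ω : Type) [MeasurableSpace Ω] (P : Measure Ω) [IsProbabilityMeasure P] (Y : Ω → ℝ) (A : ℝ),
      Measurable Y → (∀ ω, |Y ω| ≤ A) →
      ∀ r : ℝ, 0 < r → ∀ F : ℂ → ℂ, DifferentiableOn ℂ F (ball 0 r) → F 0 = 0 →
        (∀ c : ℂ, ‖c‖ < r → Complex.exp (F c) = ∫ ω, Complex.exp (c * (Y ω : ℂ)) ∂P) →
        ∀ k : ℕ, iteratedDeriv (k + 1) F 0 =
          cumulantOf (fun m => ∫ ω, ((Y ω : ℝ) : ℂ) ^ m ∂P) (k + 1) :=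
  -- CLOSED: landed p89323 (Theorems/AntiMazurCoboundariesCellForecastPressureDecayCumulantTaylorBridge.lean)
  Summit.AtomisticToContinuum.HydrodynamicLimit.Theorems.TiltAnalyticity.stub_cumulantTaylorBridge

/-- STUB S3b — FIXED-ORDER CUMULANT DECAY IN PLAIN CUMULANT CURRENCY (the CONTENT of the planner's
S3; OPEN at order 2; reshape by the lead, 2026-08-16). For `σ < σ₀`, an amplitude `κ`, every
admissible `g`, every order `k + 1 ≥ 1` and tolerance `η`: eventually in `T` (then `R ≥ R₀(T)`,
`L ≥ L₀`, `n ≤ 2L³`, any `Ψ`) the `(k+1)`-st CUMULANT of the doubled total window functional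
`Y = 2 Σᵢ aᵢ` under the cell law `P_{n,L}` is at most `η L³` in norm:
`‖κ_{k+1}(2Σᵢaᵢ)‖ ≤ η L³`. Order 1 (`2 E[Σᵢ aᵢ]`, `T`-free): bulk forecast-stationarity per volume —
needs the first-moment form of route crux `InfluenceLocality` (stmt-13916) + a cell→torus bulk
reduction + the PROVED `HomogeneousInvariance` (9621); NOT `E g(forecast) = 0` pointwise (false near
`∂Q_L` and for the expanding cluster). Order 2 (`4 Var(Σᵢaᵢ)`): per-volume zero Drude weight of the
fast observable `g` at FIXED `σ`, uniformly in the density `≤ 2` = the cell twin of the shared L²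
milestone `FastObservableMeanErgodic` (stmt-10952), OPEN in print (BodineauEtAl2024 Thm 1.2 is its
Boltzmann–Grad shadow); all of `g ⊥ span(1,v,|v|²)` is used (conserved components are Drude weights).
Order ≥ 3: Cesàro decay of truncated `k`-point time correlations per volume, same wall, no uniformity
in the order asked (that is S1). Consistency: `n = O(1)` and collisionless cells are absorbed by the
per-volume slack (`|κ_{k+1}| ≲ ρ L³ min(C_k κ^{k+1}, C_k/(ρσ²T)^k)`, `sup_ρ = O(C_k/(σ²T))`); the
orthogonality-free mutation is FALSE at order 1 (drefute `stub_fixedOrderCumulantDecay_false_without_orthogonality`,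
`g ≡ κ`). -/
theorem stub_cellCumulantDecay :
    ∃ σ₀ : ℝ, 0 < σ₀ ∧ ∀ σ : ℝ, 0 < σ → σ < σ₀ → ∃ κ : ℝ, 0 < κ ∧ ∀ g : V3 → ℝ, Continuous g →
      (∀ v, |g v| ≤ κ) →
      (∀ (c₀ c₂ : ℝ) (b : V3),
        ∫ v, g v * (c₀ + inner ℝ b v + c₂ * ‖v‖ ^ 2) ∂(stdGaussian V3) = 0) →
      ∀ k : ℕ, ∀ η : ℝ, 0 < η → ∃ T₀ : ℝ, 0 < T₀ ∧ ∀ T : ℝ, T₀ ≤ T → ∃ R₀ : ℝ, 0 < R₀ ∧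
        ∀ R : ℝ, R₀ ≤ R → ∃ L₀ : ℝ, 0 < L₀ ∧ ∀ L : ℝ, L₀ ≤ L → ∀ n : ℕ, (n : ℝ) ≤ 2 * L ^ 3 →
          ∀ Ψ : (k : ℕ) → HardSphereFlow (Euclidean.geometry (Fin 3)) σ k,
            ‖cumulantOf (fun m => ∫ z, ((2 * ∑ i : Fin n, windowAvg Ψ R T g z i : ℝ) : ℂ) ^ m
                ∂(cellLaw σ n L (Ψ n))) (k + 1)‖ ≤ η * L ^ 3 := by
  sorry

end Holds

/-! ## Stub statements by name (D-0027 §3.3: the hypotheses of `_of` are these `Prop`s) -/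

/-- Statement of registered stub S0 (`Holds.stub_objects`), by name. -/
def stub_objects : Prop := type_of% Holds.stub_objects
/-- Statement of registered stub S1 (`Holds.stub_siteSummableLabelCumulants`), by name. -/
def stub_siteSummableLabelCumulants : Prop := type_of% Holds.stub_siteSummableLabelCumulants
/-- Statement of registered stub S2a (`Holds.stub_polymerRepresentation`), by name. -/
def stub_polymerRepresentation : Prop := type_of% Holds.stub_polymerRepresentation
/-- Statement of registered stub S2b (`Holds.stub_labelCumulantDifferentiable`), by name. -/
def stub_labelCumulantDifferentiable : Prop := type_of% Holds.stub_labelCumulantDifferentiable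
/-- Statement of registered stub S2c (`Holds.stub_dobrushinHolomorphicLog`), by name. -/
def stub_dobrushinHolomorphicLog : Prop := type_of% Holds.stub_dobrushinHolomorphicLog
/-- Statement of registered stub S3a (`Holds.stub_cumulantTaylorBridge`), by name. -/
def stub_cumulantTaylorBridge : Prop := type_of% Holds.stub_cumulantTaylorBridge
/-- Statement of registered stub S3b (`Holds.stub_cellCumulantDecay`), by name. -/
def stub_cellCumulantDecay : Prop := type_of% Holds.stub_cellCumulantDecay

/-! ## Proved: the planner's stub 3 (fixed-order decay of the jet of the normalised log) from S3a, S3b -/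

/-- FIXED-ORDER CUMULANT DECAY (the planner's registered stub 3, branch-free jet form; now a consequence
of S3a/S3b): for `σ < σ₀`, an amplitude `κ`, every admissible `g`, every ORDER `k` and tolerance `η`:
eventually in `T` (then `R ≥ R₀(T)`, `L ≥ L₀`, `n ≤ 2L³`, any `Ψ`), every local normalised logarithm
`q` of the tilt partition function (`q` holomorphic on some `|c| < r`, `q(0) = 0`, `exp(L³ q) = Z`)
has `‖q^{(k)}(0)‖ ≤ η`. -/
def FixedOrderCumulantDecay : Prop :=
    ∃ σ₀ : ℝ, 0 < σ₀ ∧ ∀ σ : ℝ, 0 < σ → σ < σ₀ → ∃ κ : ℝ, 0 < κ ∧ ∀ g : V3 → ℝ, Continuous g →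
      (∀ v, |g v| ≤ κ) →
      (∀ (c₀ c₂ : ℝ) (b : V3),
        ∫ v, g v * (c₀ + inner ℝ b v + c₂ * ‖v‖ ^ 2) ∂(stdGaussian V3) = 0) →
      ∀ k : ℕ, ∀ η : ℝ, 0 < η → ∃ T₀ : ℝ, 0 < T₀ ∧ ∀ T : ℝ, T₀ ≤ T → ∃ R₀ : ℝ, 0 < R₀ ∧
        ∀ R : ℝ, R₀ ≤ R → ∃ L₀ : ℝ, 0 < L₀ ∧ ∀ L : ℝ, L₀ ≤ L → ∀ n : ℕ, (n : ℝ) ≤ 2 * L ^ 3 →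
          ∀ Ψ : (k : ℕ) → HardSphereFlow (Euclidean.geometry (Fin 3)) σ k,
            ∀ r : ℝ, 0 < r → ∀ q : ℂ → ℂ, DifferentiableOn ℂ q (ball 0 r) → q 0 = 0 →
              (∀ c : ℂ, ‖c‖ < r → Complex.exp ((L : ℂ) ^ 3 * q c) = tiltZ n Ψ R T L g c) →
              ‖iteratedDeriv k q 0‖ ≤ η

/-- **The planner's stub 3 from the reshaped stubs**: `stub_cumulantTaylorBridge → stub_cellCumulantDecay
→ FixedOrderCumulantDecay`. Order `0` is `q 0 = 0`; at order `k + 1`, with `Y = 2Σᵢaᵢ` (measurable,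
`|Y| ≤ 2nκ`) and `F = L³ q` (so `exp F = Z = E e^{cY}`), S3a gives `L³ q^{(k+1)}(0) = κ_{k+1}(Y)` and S3b
bounds the latter by `η L³`; the cell law is a probability measure for `σ ≤ 3/16`, `L ≥ 1`, `n ≤ 2L³`
(landed `isProbabilityMeasure_cellLaw`), which the thresholds `σ₀ ⊓ 3/16`, `L₀ ⊔ 1` enforce. -/
theorem fixedOrderCumulantDecay_of_parts (h3a : stub_cumulantTaylorBridge) (h3b : stub_cellCumulantDecay) :
    FixedOrderCumulantDecay := by
  have HA := (h3a : type_of% Holds.stub_cumulantTaylorBridge)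
  have HB := (h3b : type_of% Holds.stub_cellCumulantDecay)
  obtain ⟨σ₀, hσ₀, HB⟩ := HB
  refine ⟨min σ₀ (3 / 16), lt_min hσ₀ (by norm_num), fun σ hσ hσlt => ?_⟩
  have hσ₀' : σ < σ₀ := hσlt.trans_le (min_le_left _ _)
  have h316 : σ ≤ 3 / 16 := (hσlt.trans_le (min_le_right _ _)).le
  obtain ⟨κ, hκ, HB⟩ := HB σ hσ hσ₀'
  refine ⟨κ, hκ, fun g hg hgb horth k η hη => ?_⟩
  cases k with
  | zero =>
    -- order 0: `q 0 = 0`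
    refine ⟨1, one_pos, fun T _ => ⟨1, one_pos, fun R _ => ⟨1, one_pos,
      fun L _ n _ Ψ r _ q _ hq0 _ => ?_⟩⟩⟩
    rw [iteratedDeriv_zero, hq0, norm_zero]
    exact hη.le
  | succ k =>
    obtain ⟨T₀, hT₀, HT⟩ := HB g hg hgb horth k η hη
    refine ⟨T₀, hT₀, fun T hT => ?_⟩
    have hTpos : 0 < T := hT₀.trans_le hT
    obtain ⟨R₀, hR₀, HR⟩ := HT T hT
    refine ⟨R₀, hR₀, fun R hR => ?_⟩
    obtain ⟨L₀, hL₀, HL⟩ := HR R hR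
    refine ⟨max L₀ 1, lt_max_of_lt_left hL₀, fun L hL n hn Ψ r hr q hqd hq0 hqZ => ?_⟩
    have hL₀L : L₀ ≤ L := le_of_max_le_left hL
    have hL1 : 1 ≤ L := le_of_max_le_right hL
    have hLpos : 0 < L := one_pos.trans_le hL1
    have hbound := HL L hL₀L n hn Ψ
    -- the cell law is a probability measure
    haveI hP : IsProbabilityMeasure (cellLaw σ n L (Ψ n)) :=
      Theorems.CellForecastPressureDecay.isProbabilityMeasure_cellLaw h316 hL1 hn (Ψ n)
    -- the doubled total window functional
    set Y : Config n (Fin 3) V3 → ℝ := fun z => 2 * ∑ i : Fin n, windowAvg Ψ R T g z i with hY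
    have hYm : Measurable Y :=
      (Finset.measurable_sum _ fun i _ => measurable_windowAvg Ψ R T hg.measurable i).const_mul _
    have hYb : ∀ z, |Y z| ≤ 2 * (n * κ) := by
      intro z
      rw [hY, abs_mul, abs_two]
      refine mul_le_mul_of_nonneg_left ?_ (by norm_num)
      calc |∑ i : Fin n, windowAvg Ψ R T g z i| ≤ ∑ i : Fin n, |windowAvg Ψ R T g z i| :=
            Finset.abs_sum_le_sum_abs _ _
        _ ≤ ∑ _i : Fin n, κ := Finset.sum_le_sum fun i _ => abs_windowAvg_le Ψ hTpos hgb z i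
        _ = n * κ := by simp
    -- `F = L³ q` is a local holomorphic logarithm of the moment generating function of `Y`
    have hFd : DifferentiableOn ℂ (fun c => (L : ℂ) ^ 3 * q c) (ball 0 r) :=
      (differentiableOn_const _).mul hqd
    have hF0 : (fun c => (L : ℂ) ^ 3 * q c) 0 = 0 := by simp [hq0]
    have hFexp : ∀ c : ℂ, ‖c‖ < r → Complex.exp ((fun c => (L : ℂ) ^ 3 * q c) c) =
        ∫ z, Complex.exp (c * (Y z : ℂ)) ∂(cellLaw σ n L (Ψ n)) := by
      intro c hc
      rw [hqZ c hc]
      simp only [tiltZ, hY]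
      refine integral_congr_ae (Eventually.of_forall fun z => ?_)
      push_cast
      ring_nf
    have hbridge := HA (Config n (Fin 3) V3) (cellLaw σ n L (Ψ n)) Y (2 * (n * κ)) hYm hYb r hr
      (fun c => (L : ℂ) ^ 3 * q c) hFd hF0 hFexp k
    -- `L³ q^{(k+1)}(0) = κ_{k+1}(Y)`
    rw [iteratedDeriv_const_mul_field] at hbridge
    have hnorm : ‖(L : ℂ) ^ 3 * iteratedDeriv (k + 1) q 0‖ ≤ η * L ^ 3 := by
      rw [hbridge]
      exact hbound
    rw [norm_mul, norm_pow, Complex.norm_real, Real.norm_eq_abs, abs_of_pos hLpos] at hnorm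
    have hL3 : 0 < L ^ 3 := pow_pos hLpos 3
    nlinarith [norm_nonneg (iteratedDeriv (k + 1) q 0)]

/-! ## Proved: the planner's stub 2 (Kotecký–Preiss log of the label field) from S0, S2a, S2b, S2c -/

/-- KOTECKÝ–PREISS WITH A HOLOMORPHIC PARAMETER for the label field of bounded real variables (the
planner's registered stub 2, now a consequence of S0/S2a/S2b/S2c): IF on the tilt disc `|c| < ρ` the
joint cumulants of `(e^{2c w_j} − 1)_j` satisfy the site criterion `Σ_{B∋i}‖κ_B(c)‖e^{a|B|} ≤ a`, THEN
`E e^{2cΣ_j w_j}` has a HOLOMORPHIC logarithm `q` on the disc with `q(0) = 0` and `‖q(c)‖ ≤ a·n`. -/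
def LabelFieldHolomorphicLog : Prop :=
  ∀ (Ω : Type) [MeasurableSpace Ω] (P : Measure Ω) [IsProbabilityMeasure P] (n : ℕ)
    (w : Fin n → Ω → ℝ) (A : ℝ), (∀ j, Measurable (w j)) → (∀ j ω, |w j ω| ≤ A) →
    ∀ (ρ a : ℝ), 0 < ρ → 0 < a →
    (∀ c : ℂ, ‖c‖ < ρ → ∀ i : Fin n,
      ∑ B ∈ (Finset.univ : Finset (Finset (Fin n))).filter (fun B => i ∈ B),
        ‖jointCumulant P (labelVar w c) B‖ * Real.exp (a * B.card) ≤ a) →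
    ∃ q : ℂ → ℂ, DifferentiableOn ℂ q (ball 0 ρ) ∧ q 0 = 0 ∧ ∀ c : ℂ, ‖c‖ < ρ →
      Complex.exp (q c) = ∫ ω, Complex.exp (2 * c * ((∑ j, w j ω : ℝ) : ℂ)) ∂P ∧
        ‖q c‖ ≤ a * n

/-- The label variables are measurable. -/
theorem measurable_labelVar {Ω : Type*} [MeasurableSpace Ω] {n : ℕ} {w : Fin n → Ω → ℝ}
    (hw : ∀ j, Measurable (w j)) (c : ℂ) (j : Fin n) : Measurable (labelVar w c j) :=
  (Complex.measurable_exp.comp (measurable_const.mul (Complex.measurable_ofReal.comp (hw j)))).sub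
    measurable_const

/-- `‖u_j(c)‖ ≤ e^{2‖c‖|A|} + 1` for `|w_j| ≤ A`. -/
theorem norm_labelVar_le {Ω : Type*} {n : ℕ} {w : Fin n → Ω → ℝ} {A : ℝ}
    (hwb : ∀ j ω, |w j ω| ≤ A) (c : ℂ) (j : Fin n) (ω : Ω) :
    ‖labelVar w c j ω‖ ≤ Real.exp (2 * ‖c‖ * |A|) + 1 := by
  unfold labelVar
  refine (norm_sub_le _ _).trans ?_
  rw [norm_one, Complex.norm_exp]
  refine add_le_add (Real.exp_le_exp.2 ?_) le_rfl
  calc (2 * c * (w j ω : ℂ)).re ≤ ‖2 * c * (w j ω : ℂ)‖ := Complex.re_le_norm _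
    _ = 2 * ‖c‖ * |w j ω| := by
        rw [norm_mul, norm_mul, Complex.norm_real, Real.norm_eq_abs, Complex.norm_two]
    _ ≤ 2 * ‖c‖ * |A| :=
        mul_le_mul_of_nonneg_left ((hwb j ω).trans (le_abs_self A)) (by positivity)

/-- `∏_j (1 + u_j(c)) = exp(2c Σ_j w_j)`. -/
theorem prod_one_add_labelVar {Ω : Type*} {n : ℕ} (w : Fin n → Ω → ℝ) (c : ℂ) (ω : Ω) :
    ∏ j ∈ (Finset.univ : Finset (Fin n)), (1 + labelVar w c j ω) =
      Complex.exp (2 * c * ((∑ j, w j ω : ℝ) : ℂ)) := by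
  simp only [labelVar, add_sub_cancel, ← Complex.exp_sum]
  congr 1
  push_cast
  rw [Finset.mul_sum]

/-- **The planner's stub 2 from the reshaped stubs**: `stub_objects → stub_polymerRepresentation →
stub_labelCumulantDifferentiable → stub_dobrushinHolomorphicLog → LabelFieldHolomorphicLog`. With
`κ c B := jointCumulant P (labelVar w c) B`: S2b gives holomorphy, S0 gives `κ 0 B = 0` (the label
variables vanish at zero tilt) and `κ c ∅ = 0`, S2c gives the holomorphic log `q` of
`subsetGasZ (κ c) univ`, and S2a identifies the latter with `E∏_j(1+u_j(c)) = E e^{2cΣw_j}`. -/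
theorem labelFieldHolomorphicLog_of_parts (h₀ : stub_objects) (h2a : stub_polymerRepresentation)
    (h2b : stub_labelCumulantDifferentiable) (h2c : stub_dobrushinHolomorphicLog) :
    LabelFieldHolomorphicLog := by
  have H0 := (h₀ : type_of% Holds.stub_objects)
  have H2a := (h2a : type_of% Holds.stub_polymerRepresentation)
  have H2b := (h2b : type_of% Holds.stub_labelCumulantDifferentiable)
  have H2c := (h2c : type_of% Holds.stub_dobrushinHolomorphicLog)
  intro Ω _ P _ n w A hw hwb ρ a hρ ha hsite
  set κ : ℂ → Finset (Fin n) → ℂ := fun c B => jointCumulant P (labelVar w c) B with hκ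
  have hdiff : ∀ B : Finset (Fin n), DifferentiableOn ℂ (fun c => κ c B) (ball 0 ρ) :=
    fun B => (H2b Ω P n w A hw hwb B).differentiableOn
  have hvan : ∀ (u : Fin n → Ω → ℂ), (∀ j ω, u j ω = 0) → ∀ B, jointCumulant P u B = 0 := by
    intro u hu B
    refine H0.2.1 (Fin n) (momentOf P u) (fun d hd => ?_) B
    obtain ⟨j, hj⟩ := hd
    have : ∀ ω, ∏ k ∈ d, u k ω = 0 := fun ω => Finset.prod_eq_zero hj (hu j ω)
    simp [momentOf, this]
  have hzero : ∀ B : Finset (Fin n), κ 0 B = 0 :=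
    fun B => hvan (labelVar w 0) (fun j ω => by simp [labelVar]) B
  have hempty : ∀ c : ℂ, κ c ∅ = 0 := by
    intro c
    show cumulantOfMoments (momentOf P (labelVar w c)) ∅ = 0
    unfold cumulantOfMoments
    rw [Finset.strongInduction_eq, dif_neg Finset.not_nonempty_empty]
  obtain ⟨q, hqd, hq0, hq⟩ := H2c n κ ρ a hρ ha hdiff hzero hempty hsite
  refine ⟨q, hqd, hq0, fun c hc => ⟨?_, (hq c hc).2⟩⟩
  rw [(hq c hc).1]
  have hrep := H2a Ω P n (labelVar w c) (Real.exp (2 * ‖c‖ * |A|) + 1) (measurable_labelVar hw c)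
    (norm_labelVar_le hwb c) Finset.univ
  rw [← hrep]
  exact integral_congr_ae (Eventually.of_forall fun ω => prod_one_add_labelVar w c ω)

/-! ## Proved: the transfer lemma (effective Cauchy-estimate form of the card's `TaylorwiseNullTransfer`) -/

/-- **Taylor tail control** (the card's first lemma, effective form; PROVED). For every bound `M` and
tolerance `ε > 0` there are an order `K` and a threshold `η > 0` such that every `F` holomorphic on
the disc `|c| < 2` with `‖F‖ ≤ M` there and `‖F^{(k)}(0)‖ ≤ η` for `k < K` satisfies `‖F‖ ≤ ε` on
`|c| ≤ 1`. Proof: Taylor expansion at `0` (`Complex.hasSum_taylorSeries_on_ball`), Cauchy's estimate on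
the circle `|c| = 3/2` (`Complex.norm_iteratedDeriv_le_of_forall_mem_sphere_norm_le`) bounds the
`k`-th term by `M(2/3)^k` on the unit disc, the tail from `K` by `3M(2/3)^K ≤ ε/2`, the head by
`K·η ≤ ε/2`. -/
theorem taylorTailControl (M ε : ℝ) (hε : 0 < ε) :
    ∃ K : ℕ, ∃ η : ℝ, 0 < η ∧ ∀ F : ℂ → ℂ, DifferentiableOn ℂ F (ball 0 2) →
      (∀ c : ℂ, ‖c‖ < 2 → ‖F c‖ ≤ M) → (∀ k : ℕ, k < K → ‖iteratedDeriv k F 0‖ ≤ η) →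
      ∀ c : ℂ, ‖c‖ ≤ 1 → ‖F c‖ ≤ ε := by
  set M' : ℝ := max M 0 with hM'
  have hM'0 : 0 ≤ M' := le_max_right _ _
  obtain ⟨K, hK⟩ : ∃ K : ℕ, (2 / 3 : ℝ) ^ K < ε / 2 / (3 * M' + 1) :=
    exists_pow_lt_of_lt_one (by positivity) (by norm_num)
  have hK' : 3 * M' * (2 / 3 : ℝ) ^ K ≤ ε / 2 := by
    have h31 : 0 < 3 * M' + 1 := by positivity
    calc 3 * M' * (2 / 3 : ℝ) ^ K ≤ (3 * M' + 1) * (2 / 3 : ℝ) ^ K := by gcongr; linarith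
      _ ≤ (3 * M' + 1) * (ε / 2 / (3 * M' + 1)) := by gcongr
      _ = ε / 2 := by field_simp
  refine ⟨K, ε / (2 * (K + 1)), by positivity, fun F hF hM hD c hc => ?_⟩
  have hc1 : ‖c‖ ≤ 1 := hc
  have hc2 : c ∈ ball (0 : ℂ) 2 := by rw [mem_ball_zero_iff]; linarith
  -- Taylor series of `F` at `0`, evaluated at `c`
  have hsum : HasSum (fun m : ℕ => ((m.factorial : ℂ))⁻¹ • (c - 0) ^ m • iteratedDeriv m F 0)
      (F c) := Complex.hasSum_taylorSeries_on_ball hF hc2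
  -- Cauchy's estimates on the circle of radius 3/2
  have hR : DiffContOnCl ℂ F (ball (0 : ℂ) (3 / 2)) :=
    hF.diffContOnCl_ball (closedBall_subset_ball (by norm_num))
  have hsph : ∀ z ∈ sphere (0 : ℂ) (3 / 2), ‖F z‖ ≤ M' := fun z hz =>
    (hM z (by rw [mem_sphere_zero_iff_norm.1 hz]; norm_num)).trans (le_max_left _ _)
  have hfacpos : ∀ m : ℕ, (0 : ℝ) < m.factorial := fun m => by exact_mod_cast m.factorial_pos
  have hcauchy : ∀ m : ℕ, ‖iteratedDeriv m F 0‖ ≤ m.factorial * (M' * (2 / 3 : ℝ) ^ m) := by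
    intro m
    have h := Complex.norm_iteratedDeriv_le_of_forall_mem_sphere_norm_le m (by norm_num) hR hsph
    have e : (m.factorial : ℝ) * M' / (3 / 2) ^ m = m.factorial * (M' * (2 / 3) ^ m) := by
      rw [mul_div_assoc, div_eq_mul_inv, ← inv_pow]
      norm_num
    rw [e] at h
    exact h
  -- the terms of the series
  have hnormA : ∀ m : ℕ, ‖((m.factorial : ℂ))⁻¹ • (c - 0) ^ m • iteratedDeriv m F 0‖ =
      (m.factorial : ℝ)⁻¹ * ‖c‖ ^ m * ‖iteratedDeriv m F 0‖ := by
    intro m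
    rw [norm_smul, norm_smul, norm_inv, norm_pow, sub_zero, Complex.norm_natCast, mul_assoc]
  have hcm : ∀ m : ℕ, ‖c‖ ^ m ≤ 1 := fun m => pow_le_one₀ (norm_nonneg _) hc1
  have hgeom : ∀ m : ℕ, ‖((m.factorial : ℂ))⁻¹ • (c - 0) ^ m • iteratedDeriv m F 0‖ ≤
      M' * (2 / 3 : ℝ) ^ m := by
    intro m
    rw [hnormA]
    have h1 : (m.factorial : ℝ)⁻¹ * ‖c‖ ^ m ≤ (m.factorial : ℝ)⁻¹ :=
      mul_le_of_le_one_right (inv_nonneg.2 (hfacpos m).le) (hcm m)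
    calc (m.factorial : ℝ)⁻¹ * ‖c‖ ^ m * ‖iteratedDeriv m F 0‖
        ≤ (m.factorial : ℝ)⁻¹ * (m.factorial * (M' * (2 / 3 : ℝ) ^ m)) :=
          mul_le_mul h1 (hcauchy m) (norm_nonneg _) (inv_nonneg.2 (hfacpos m).le)
      _ = M' * (2 / 3 : ℝ) ^ m := by rw [inv_mul_cancel_left₀ (hfacpos m).ne']
  have hhead : ∀ m : ℕ, m < K → ‖((m.factorial : ℂ))⁻¹ • (c - 0) ^ m • iteratedDeriv m F 0‖ ≤
      ε / (2 * (K + 1)) := by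
    intro m hm
    rw [hnormA]
    have h1 : (m.factorial : ℝ)⁻¹ * ‖c‖ ^ m ≤ 1 := by
      calc (m.factorial : ℝ)⁻¹ * ‖c‖ ^ m ≤ (m.factorial : ℝ)⁻¹ :=
            mul_le_of_le_one_right (inv_nonneg.2 (hfacpos m).le) (hcm m)
        _ ≤ 1 := inv_le_one_of_one_le₀ (by exact_mod_cast Nat.succ_le_of_lt m.factorial_pos)
    calc (m.factorial : ℝ)⁻¹ * ‖c‖ ^ m * ‖iteratedDeriv m F 0‖ ≤ 1 * (ε / (2 * (K + 1))) :=
          mul_le_mul h1 (hD m hm) (norm_nonneg _) zero_le_one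
      _ = ε / (2 * (K + 1)) := one_mul _
  -- split the series at order `K`
  have htail := (hasSum_nat_add_iff' K).2 hsum
  have hgeomS : HasSum (fun m : ℕ => M' * (2 / 3 : ℝ) ^ K * (2 / 3 : ℝ) ^ m)
      (M' * (2 / 3 : ℝ) ^ K * (1 - 2 / 3)⁻¹) :=
    (hasSum_geometric_of_lt_one (by norm_num) (by norm_num)).mul_left _
  have htailb : ‖F c - ∑ i ∈ Finset.range K,
      ((i.factorial : ℂ))⁻¹ • (c - 0) ^ i • iteratedDeriv i F 0‖ ≤
        M' * (2 / 3 : ℝ) ^ K * (1 - 2 / 3)⁻¹ :=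
    htail.norm_le_of_bounded hgeomS fun m => by
      calc ‖(((m + K).factorial : ℂ))⁻¹ • (c - 0) ^ (m + K) • iteratedDeriv (m + K) F 0‖
          ≤ M' * (2 / 3 : ℝ) ^ (m + K) := hgeom _
        _ = M' * (2 / 3 : ℝ) ^ K * (2 / 3 : ℝ) ^ m := by rw [pow_add]; ring
  have hheadb : ‖∑ i ∈ Finset.range K, ((i.factorial : ℂ))⁻¹ • (c - 0) ^ i • iteratedDeriv i F 0‖ ≤
      K * (ε / (2 * (K + 1))) := by
    calc ‖∑ i ∈ Finset.range K, ((i.factorial : ℂ))⁻¹ • (c - 0) ^ i • iteratedDeriv i F 0‖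
        ≤ ∑ i ∈ Finset.range K, ‖((i.factorial : ℂ))⁻¹ • (c - 0) ^ i • iteratedDeriv i F 0‖ :=
          norm_sum_le _ _
      _ ≤ ∑ i ∈ Finset.range K, ε / (2 * (K + 1)) :=
          Finset.sum_le_sum fun i hi => hhead i (Finset.mem_range.1 hi)
      _ = K * (ε / (2 * (K + 1))) := by simp
  have hK1 : (0 : ℝ) < K + 1 := by positivity
  calc ‖F c‖ = ‖(F c - ∑ i ∈ Finset.range K,
          ((i.factorial : ℂ))⁻¹ • (c - 0) ^ i • iteratedDeriv i F 0) +
        ∑ i ∈ Finset.range K, ((i.factorial : ℂ))⁻¹ • (c - 0) ^ i • iteratedDeriv i F 0‖ := by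
          rw [sub_add_cancel]
    _ ≤ ‖F c - ∑ i ∈ Finset.range K,
          ((i.factorial : ℂ))⁻¹ • (c - 0) ^ i • iteratedDeriv i F 0‖ +
        ‖∑ i ∈ Finset.range K, ((i.factorial : ℂ))⁻¹ • (c - 0) ^ i • iteratedDeriv i F 0‖ :=
          norm_add_le _ _
    _ ≤ M' * (2 / 3 : ℝ) ^ K * (1 - 2 / 3)⁻¹ + K * (ε / (2 * (K + 1))) := add_le_add htailb hheadb
    _ ≤ ε / 2 + ε / 2 := by
        apply add_le_add
        · have e : M' * (2 / 3 : ℝ) ^ K * (1 - 2 / 3)⁻¹ = 3 * M' * (2 / 3 : ℝ) ^ K := by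
            norm_num; ring
          rw [e]
          exact hK'
        · calc (K : ℝ) * (ε / (2 * (K + 1))) = ε / 2 * (K / (K + 1)) := by
                field_simp
            _ ≤ ε / 2 * 1 := by
                gcongr
                exact (div_le_one hK1).2 (by linarith)
            _ = ε / 2 := mul_one _
    _ = ε := by ring

/-! ## Proved: bookkeeping used by the composition -/

/-- Conjunction of two frames (thresholds merged by `max`). -/
theorem Frame.and {σ : ℝ} {P Q : ℝ → ℝ → ℝ → (n : ℕ) → Flows σ → Prop} {T₁ T₂ : ℝ}
    (h₁ : Frame P T₁) (h₂ : Frame Q T₂) :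
    Frame (fun T R L n Ψ => P T R L n Ψ ∧ Q T R L n Ψ) (max T₁ T₂) := by
  intro T hT
  obtain ⟨R₁, hR₁, h₁⟩ := h₁ T (le_of_max_le_left hT)
  obtain ⟨R₂, hR₂, h₂⟩ := h₂ T (le_of_max_le_right hT)
  refine ⟨max R₁ R₂, lt_max_of_lt_left hR₁, fun R hR => ?_⟩
  obtain ⟨L₁, hL₁, h₁⟩ := h₁ R (le_of_max_le_left hR)
  obtain ⟨L₂, hL₂, h₂⟩ := h₂ R (le_of_max_le_right hR)
  exact ⟨max L₁ L₂, lt_max_of_lt_left hL₁, fun L hL n hn Ψ =>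
    ⟨h₁ L (le_of_max_le_left hL) n hn Ψ, h₂ L (le_of_max_le_right hL) n hn Ψ⟩⟩

/-- Monotonicity of frames in the predicate. -/
theorem Frame.mono {σ : ℝ} {P Q : ℝ → ℝ → ℝ → (n : ℕ) → Flows σ → Prop} {T₀ : ℝ}
    (h : Frame P T₀) (hPQ : ∀ T R L n Ψ, P T R L n Ψ → Q T R L n Ψ) : Frame Q T₀ := by
  intro T hT
  obtain ⟨R₀, hR₀, h⟩ := h T hT
  refine ⟨R₀, hR₀, fun R hR => ?_⟩
  obtain ⟨L₀, hL₀, h⟩ := h R hR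
  exact ⟨L₀, hL₀, fun L hL n hn Ψ => hPQ _ _ _ _ _ (h L hL n hn Ψ)⟩

/-- Finitely many frames hold simultaneously, eventually. -/
theorem frame_finite {σ : ℝ} {P : ℕ → ℝ → ℝ → ℝ → (n : ℕ) → Flows σ → Prop}
    (h : ∀ k : ℕ, ∃ T₀ : ℝ, 0 < T₀ ∧ Frame (P k) T₀) :
    ∀ K : ℕ, ∃ T₀ : ℝ, 0 < T₀ ∧ Frame (fun T R L n Ψ => ∀ k : ℕ, k < K → P k T R L n Ψ) T₀
  | 0 => ⟨1, one_pos, fun T _ => ⟨1, one_pos, fun R _ => ⟨1, one_pos,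
      fun L _ n _ Ψ k hk => absurd hk (Nat.not_lt_zero k)⟩⟩⟩
  | K + 1 => by
    obtain ⟨T₀, hT₀, hK⟩ := frame_finite h K
    obtain ⟨T₁, hT₁, h₁⟩ := h K
    refine ⟨max T₀ T₁, lt_max_of_lt_left hT₀, (hK.and h₁).mono ?_⟩
    rintro T R L n Ψ ⟨hA, hB⟩ k hk
    rcases (Nat.lt_succ_iff.1 hk).lt_or_eq with hk' | rfl
    · exact hA k hk'
    · exact hB

/-! ## Composition (sorry-free): the registered stubs ⟹ the crux BY NAME -/

/-- **The skeleton theorem** (hypotheses = the two OPEN stubs S1, S3b; the closed stubs are discharged inside by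
their landed theorems). `σ₀ := min (min σ₁ σ₃) (3/16)`, `κ := min κ₁ κ₃`; given `g, δ`:
`(K, η) := taylorTailControl (2a) δ` with `a` the KP weight of stub 1; `T := max T₁ T₃` merges the
horizon of stub 1 with those of stub 3 for the orders `k < K` (`frame_finite`), then `R₀`, then
`L₀ := max L₀' 1`. At `(T, R, L, n, Ψ)`: the cell law is a probability measure (landed Negative §1),
`LabelFieldHolomorphicLog` (from S0/S2a/S2b/S2c, fed stub 1's site criterion, measurability and
`|aᵢ| ≤ κ`) gives the holomorphic log `q'`,
`‖q'‖ ≤ a n ≤ 2aL³`; `q := L⁻³q'` has `‖q‖ ≤ 2a` on `|c| < 2`, `q 0 = 0`, `exp(L³q) = Z`, hence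
(stub 3) `‖q^{(k)}(0)‖ ≤ η` for `k < K`, hence (`taylorTailControl`) `‖q c‖ ≤ δ` for `|c| ≤ 1`; so
`‖Z(c)‖ ≤ e^{δL³}`, and at real `c` the crux's left side is `‖Z(c)‖`. -/
theorem CellForecastPressureDecay_of
    (h₁ : stub_siteSummableLabelCumulants) (h3b : stub_cellCumulantDecay) :
    Summit.AtomisticToContinuum.HydrodynamicLimit.Theses.AntiMazurCoboundaries.CellForecastPressureDecay := by
  have H1 := (h₁ : type_of% Holds.stub_siteSummableLabelCumulants)
  -- the CLOSED stubs (S0, S2a, S2b, S2c, S3a) are discharged by their landed theorems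
  have H2 : LabelFieldHolomorphicLog := labelFieldHolomorphicLog_of_parts Holds.stub_objects
    Holds.stub_polymerRepresentation Holds.stub_labelCumulantDifferentiable
    Holds.stub_dobrushinHolomorphicLog
  have H3 : FixedOrderCumulantDecay := fixedOrderCumulantDecay_of_parts Holds.stub_cumulantTaylorBridge h3b
  obtain ⟨σ₁, hσ₁, H1⟩ := H1
  obtain ⟨σ₃, hσ₃, H3⟩ := H3
  refine ⟨min (min σ₁ σ₃) (3 / 16), lt_min (lt_min hσ₁ hσ₃) (by norm_num), fun σ hσ hσlt => ?_⟩
  have hσ1 : σ < σ₁ := hσlt.trans_le ((min_le_left _ _).trans (min_le_left _ _))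
  have hσ3 : σ < σ₃ := hσlt.trans_le ((min_le_left _ _).trans (min_le_right _ _))
  have hσ' : σ ≤ 3 / 16 := (hσlt.trans_le (min_le_right _ _)).le
  obtain ⟨κ₁, hκ₁, H1⟩ := H1 σ hσ hσ1
  obtain ⟨κ₃, hκ₃, H3⟩ := H3 σ hσ hσ3
  refine ⟨min κ₁ κ₃, lt_min hκ₁ hκ₃, fun g hg hgb horth δ hδ => ?_⟩
  have hgb1 : ∀ v, |g v| ≤ κ₁ := fun v => (hgb v).trans (min_le_left _ _)
  have hgb3 : ∀ v, |g v| ≤ κ₃ := fun v => (hgb v).trans (min_le_right _ _)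
  obtain ⟨a, ha, T₁, hT₁, H1⟩ := H1 g hg hgb1 horth
  have H3g := H3 g hg hgb3 horth
  -- the constants of the transfer, for the bound `2a` and the tolerance `δ`
  obtain ⟨K, η, hη, HT⟩ := taylorTailControl (2 * a) δ hδ
  -- the two frames
  have hS : Frame (fun T R L n Ψ => ∀ c : ℂ, ‖c‖ < 2 → ∀ i : Fin n,
      ∑ B ∈ (Finset.univ : Finset (Finset (Fin n))).filter (fun B => i ∈ B),
        ‖jointCumulant (cellLaw σ n L (Ψ n)) (labelField Ψ R T g c) B‖ *
          Real.exp (a * B.card) ≤ a) T₁ := H1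
  have hF : ∀ k : ℕ, ∃ T₀ : ℝ, 0 < T₀ ∧ Frame (fun T R L n Ψ => ∀ r : ℝ, 0 < r → ∀ q : ℂ → ℂ,
      DifferentiableOn ℂ q (ball 0 r) → q 0 = 0 →
      (∀ c : ℂ, ‖c‖ < r → Complex.exp ((L : ℂ) ^ 3 * q c) = tiltZ n Ψ R T L g c) →
      ‖iteratedDeriv k q 0‖ ≤ η) T₀ := fun k => H3g k η hη
  obtain ⟨T₃, hT₃, hF⟩ := frame_finite hF K
  have hSF := hS.and hF
  refine ⟨max T₁ T₃, lt_max_of_lt_left hT₁, ?_⟩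
  have hTpos : 0 < max T₁ T₃ := lt_max_of_lt_left hT₁
  obtain ⟨R₀, hR₀, hSF⟩ := hSF (max T₁ T₃) le_rfl
  refine ⟨R₀, hR₀, fun R hR => ?_⟩
  obtain ⟨L₀, hL₀, hSF⟩ := hSF R hR
  refine ⟨max L₀ 1, lt_max_of_lt_left hL₀, fun L hL n hn Ψ c hc => ?_⟩
  have hL₀L : L₀ ≤ L := le_of_max_le_left hL
  have hL1 : 1 ≤ L := le_of_max_le_right hL
  have hLpos : 0 < L := one_pos.trans_le hL1
  obtain ⟨hSite, hDer⟩ := hSF L hL₀L n hn Ψ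
  -- the cell law is a probability measure (landed Negative lemma, § 1 of the Disproof)
  haveI hP : IsProbabilityMeasure (cellLaw σ n L (Ψ n)) :=
    Theorems.CellForecastPressureDecay.isProbabilityMeasure_cellLaw hσ' hL1 hn (Ψ n)
  -- stub 2 fed with stub 1: the holomorphic volume-order logarithm
  have hmeas : ∀ j : Fin n, Measurable fun z : Config n (Fin 3) V3 =>
      windowAvg Ψ R (max T₁ T₃) g z j := fun j => measurable_windowAvg Ψ R _ hg.measurable j
  have hbdd : ∀ (j : Fin n) (z : Config n (Fin 3) V3), |windowAvg Ψ R (max T₁ T₃) g z j| ≤ min κ₁ κ₃ :=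
    fun j z => abs_windowAvg_le Ψ hTpos hgb z j
  obtain ⟨q', hq'd, hq'0, hq'⟩ := H2 (Config n (Fin 3) V3) (cellLaw σ n L (Ψ n)) n
    (fun j z => windowAvg Ψ R (max T₁ T₃) g z j) (min κ₁ κ₃) hmeas hbdd 2 a two_pos ha hSite
  -- normalisation `q := L⁻³ q'`
  have hL3 : ((L : ℂ) ^ 3) ≠ 0 := pow_ne_zero _ (Complex.ofReal_ne_zero.2 hLpos.ne')
  have hqd : DifferentiableOn ℂ (fun c => ((L : ℂ) ^ 3)⁻¹ * q' c) (ball 0 2) :=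
    (differentiableOn_const _).mul hq'd
  have hq0 : (fun c => ((L : ℂ) ^ 3)⁻¹ * q' c) 0 = 0 := by simp [hq'0]
  have hqexp : ∀ c : ℂ, ‖c‖ < 2 →
      Complex.exp ((L : ℂ) ^ 3 * (fun c => ((L : ℂ) ^ 3)⁻¹ * q' c) c) = tiltZ n Ψ R (max T₁ T₃) L g c := by
    intro c hc
    have e : (L : ℂ) ^ 3 * (fun c => ((L : ℂ) ^ 3)⁻¹ * q' c) c = q' c := mul_inv_cancel_left₀ hL3 _
    rw [e]
    exact (hq' c hc).1
  have hqM : ∀ c : ℂ, ‖c‖ < 2 → ‖(fun c => ((L : ℂ) ^ 3)⁻¹ * q' c) c‖ ≤ 2 * a := by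
    intro c hc
    have h1 : ‖q' c‖ ≤ a * n := (hq' c hc).2
    have hL3pos : 0 < L ^ 3 := pow_pos hLpos 3
    show ‖((L : ℂ) ^ 3)⁻¹ * q' c‖ ≤ 2 * a
    rw [norm_mul, norm_inv, norm_pow, Complex.norm_real, Real.norm_eq_abs, abs_of_pos hLpos,
      inv_mul_le_iff₀ hL3pos]
    calc ‖q' c‖ ≤ a * n := h1
      _ ≤ a * (2 * L ^ 3) := by gcongr
      _ = L ^ 3 * (2 * a) := by ring
  -- stub 3: the first `K` Taylor coefficients are small
  have hqD : ∀ k : ℕ, k < K → ‖iteratedDeriv k (fun c => ((L : ℂ) ^ 3)⁻¹ * q' c) 0‖ ≤ η :=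
    fun k hk => hDer k hk 2 two_pos _ hqd hq0 hqexp
  -- the transfer: `‖q(c)‖ ≤ δ` at the real tilt `c`
  have hcC : ‖(c : ℂ)‖ ≤ 1 := by rw [Complex.norm_real, Real.norm_eq_abs]; exact hc
  have hsmall : ‖(fun c => ((L : ℂ) ^ 3)⁻¹ * q' c) (c : ℂ)‖ ≤ δ := HT _ hqd hqM hqD (c : ℂ) hcC
  -- hence `‖Z(c)‖ ≤ exp(δ L³)`
  have hZ : ‖tiltZ n Ψ R (max T₁ T₃) L g c‖ ≤ Real.exp (δ * L ^ 3) := by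
    rw [← hqexp (c : ℂ) (hcC.trans_lt (by norm_num)), Complex.norm_exp]
    apply Real.exp_le_exp.2
    calc ((L : ℂ) ^ 3 * (fun c => ((L : ℂ) ^ 3)⁻¹ * q' c) (c : ℂ)).re
        ≤ ‖(L : ℂ) ^ 3 * (fun c => ((L : ℂ) ^ 3)⁻¹ * q' c) (c : ℂ)‖ := Complex.re_le_norm _
      _ = L ^ 3 * ‖(fun c => ((L : ℂ) ^ 3)⁻¹ * q' c) (c : ℂ)‖ := by
          rw [norm_mul, norm_pow, Complex.norm_real, Real.norm_eq_abs, abs_of_pos hLpos]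
      _ ≤ L ^ 3 * δ := by gcongr
      _ = δ * L ^ 3 := by ring
  -- and at real `c` the crux's left side IS `‖Z(c)‖`
  have key := lintegral_exp_eq_norm_tiltZ (n := n) Ψ (R := R) L hTpos hg.measurable hgb c
  show ∫⁻ z, ENNReal.ofReal (Real.exp (2 * c * ∑ i : Fin n, windowAvg Ψ R (max T₁ T₃) g z i))
      ∂(cellLaw σ n L (Ψ n)) ≤ ENNReal.ofReal (Real.exp (δ * L ^ 3))
  rw [key]
  exact ENNReal.ofReal_le_ofReal hZ

/-- D-0027 §3.3 shape: the crux from the registered stubs — an `example`, so that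
`CellForecastPressureDecay_of` stays the unique theorem concluding the crux; it becomes the proof of
the item once the three `sorry`s are discharged. -/
example : Summit.AtomisticToContinuum.HydrodynamicLimit.Theses.AntiMazurCoboundaries.CellForecastPressureDecay :=
  CellForecastPressureDecay_of Holds.stub_siteSummableLabelCumulants Holds.stub_cellCumulantDecay

end

end Summit.AtomisticToContinuum.HydrodynamicLimit.Cruxes.CellForecastPressureDecay.TiltAnalyticityTransfer
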